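import Literature.NumberTheory.Sieve.KloostermanQuintilinearDerivBounds
import HarnessLib

/-!
# Mixed `(c,d)`-derivatives of the coupled weight `A(c) B(d) P(κ c d)` (Drappeau 2017, §5.5)

Topic `Literature/NumberTheory/Sieve`.  In the application of the quintilinear Kloosterman bound
(Drappeau 2017 Thm 2.1 / Assing–Blomer–Li 2021 Thm 2.3) in Drappeau 2017, §5.5, the smooth weight
in the two "smooth" variables is `F(c,d) = γ(q₀c) γ(q₀d) α(ξ q₀ c d)`, i.e. of the form
`F(c,d) = A(c) B(d) P(κ c d)` with one-variable plateau functions `A, B, P` and a coupling through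
the product `c d`.  This file computes `∂_d^j F(c,·)` exactly and bounds `∂_c^i ∂_d^j F` pointwise
in the format `DerivBound` of `KloostermanQuintilinearDerivBounds.lean` (everything proved; the only
definition is the auxiliary fixed function `powDeriv P m (t) = t^m P^{(m)}(t)`).

* `KloostermanQuintilinear.powDeriv` — `t ↦ t^m · P^{(m)}(t)`; smooth and compactly supported
  with `P` (`contDiff_powDeriv`, `hasCompactSupport_powDeriv`, `powDeriv_eq_zero`);
* `iteratedDeriv_d_coupled` — `∂_d^j [A(c)B(d')P(κcd')](d)
    = A(c) ∑_{j₁≤j} C(j,j₁) B^{(j₁)}(d) d^{-(j−j₁)} powDeriv P (j−j₁) (κcd)` (`d ≠ 0`);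
* `derivBound_A_mul_powDeriv`, `norm_iteratedDeriv_cd_coupled_le` —
  `‖∂_c^i∂_d^j F(c,d)‖ ≤ XA·XB·MQ·(uA + T/c)^i·(uB + 1/d)^j`.

## References

* S. Drappeau, Proc. London Math. Soc. (3) 114 (2017) 684–732, arXiv:1504.05549, §5.5 (the weight
  `g(𝐜,𝐝) = γ(q₀𝐝)γ(q₀𝐜)α(ξq₀𝐜𝐝)` before (5.24)). [cite: Drappeau2017, §5.5]
* E. Assing, V. Blomer, J. Li, Adv. Math. 393 (2021), arXiv:2005.13915, Theorem 2.3.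
  [cite: AssingBlomerLi2020, Theorem 2.3]
-/

noncomputable section

open scoped ContDiff Topology
open Filter Finset

namespace Literature.NumberTheory.Sieve

namespace KloostermanQuintilinear

/-- `powDeriv P m (t) = t^m · P^{(m)}(t)`. [folklore] -/
def powDeriv (P : ℝ → ℂ) (m : ℕ) (t : ℝ) : ℂ := ((t : ℂ) ^ m) * iteratedDeriv m P t

/-- `powDeriv P 0 = P`. [folklore] -/
@[simp] theorem powDeriv_zero (P : ℝ → ℂ) : powDeriv P 0 = P := by
  funext t; simp [powDeriv]

/-- Smoothness of `powDeriv P m`. [folklore] -/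
theorem contDiff_powDeriv {P : ℝ → ℂ} (hP : ContDiff ℝ ∞ P) (m : ℕ) : ContDiff ℝ ∞ (powDeriv P m) := by
  unfold powDeriv
  refine ContDiff.mul (Complex.ofRealCLM.contDiff.pow m) ?_
  rw [iteratedDeriv_eq_iterate]
  exact hP.iterate_deriv m

/-- `powDeriv P m` vanishes where `P` vanishes identically nearby. [folklore] -/
theorem powDeriv_eq_zero {P : ℝ → ℂ} {t : ℝ} (h : P =ᶠ[𝓝 t] 0) (m : ℕ) : powDeriv P m t = 0 := by
  unfold powDeriv
  have h1 := (h.iteratedDeriv m).eq_of_nhds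
  have h0 : iteratedDeriv m (0 : ℝ → ℂ) t = 0 := iteratedDeriv_fun_const_zero
  rw [h1, h0, mul_zero]

/-- Compact support of `powDeriv P m`. [folklore] -/
theorem hasCompactSupport_powDeriv {P : ℝ → ℂ} (hPs : HasCompactSupport P) (m : ℕ) :
    HasCompactSupport (powDeriv P m) := by
  unfold powDeriv
  have h : HasCompactSupport (iteratedDeriv m P) := by
    induction m with
    | zero => simpa using hPs
    | succ n ih => rw [iteratedDeriv_succ]; exact ih.deriv
  exact h.mul_left

/-- **The `d`-derivatives of the coupled weight**: for smooth `B, P`, `d ≠ 0` and any `c, κ`,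
`∂_d^j [A(c) B(d') P(κ c d')](d) = A(c) ∑_{j₁ ≤ j} C(j,j₁) B^{(j₁)}(d) · d^{-(j−j₁)} powDeriv P (j−j₁) (κcd)`
(Leibniz rule, chain rule for the dilation `d' ↦ P((κc) d')`, and `(κc)^m = d^{-m} (κcd)^m`).
[cite: Drappeau2017, §5.5] -/
theorem iteratedDeriv_d_coupled (A : ℝ → ℂ) {B P : ℝ → ℂ} (hB : ContDiff ℝ ∞ B) (hP : ContDiff ℝ ∞ P)
    (κ c : ℝ) {d : ℝ} (hd : d ≠ 0) (j : ℕ) :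
    iteratedDeriv j (fun d' => A c * B d' * P (κ * c * d')) d =
      A c * ∑ j₁ ∈ Finset.range (j + 1), (j.choose j₁ : ℂ) * iteratedDeriv j₁ B d *
        ((((d⁻¹ : ℝ) : ℂ) ^ (j - j₁)) * powDeriv P (j - j₁) (κ * c * d)) := by
  -- pull out the constant `A c`
  have e1 : (fun d' => A c * B d' * P (κ * c * d')) = fun d' => A c * (B d' * P (κ * c * d')) := by
    funext d'; ring
  rw [e1, iteratedDeriv_const_mul_field]
  congr 1
  -- Leibniz
  have hPc : ContDiff ℝ ∞ (fun d' => P (κ * c * d')) := hP.comp (contDiff_const.mul contDiff_id)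
  have hBj : ContDiffAt ℝ j B d := (hB.of_le (by exact_mod_cast le_top)).contDiffAt
  have hPj : ContDiffAt ℝ j (fun d' => P (κ * c * d')) d :=
    (hPc.of_le (by exact_mod_cast le_top)).contDiffAt
  rw [iteratedDeriv_fun_mul hBj hPj]
  refine Finset.sum_congr rfl fun j₁ hj₁ => ?_
  rw [Finset.mem_range] at hj₁
  -- the dilation
  generalize j - j₁ = m
  have hPm : ContDiff ℝ m P := hP.of_le (by exact_mod_cast le_top)
  have hdil := iteratedDeriv_comp_const_smul (n := m) hPm (κ * c)
  have e2 : (fun d' => P (κ * c * d')) = fun d' => P ((κ * c) * d') := rfl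
  rw [e2, hdil]
  simp only
  -- `(κc)^m • z = d^{-m} (κcd)^m z`
  rw [powDeriv, Complex.real_smul]
  have hdC : (d : ℂ) ≠ 0 := by exact_mod_cast hd
  have e3 : (((κ * c) ^ m : ℝ) : ℂ) = (((d⁻¹ : ℝ) : ℂ) ^ m) * ((κ * c * d : ℝ) : ℂ) ^ m := by
    push_cast
    rw [← mul_pow]
    congr 1
    field_simp
  rw [e3]
  ring

/-- The `c`-derivatives of `c' ↦ A(c') · powDeriv P m (κ d c')`: bounds `(XA·MQ, uA + T/c)` at `c`,
in both regimes `κcd ≤ T` (dilation by `κd ≤ T/c`) and `κcd > T > T₀` (the function vanishes near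
`c` because `P = 0` on `[T₀, ∞)`). [cite: Drappeau2017, §5.5] -/
theorem derivBound_A_mul_powDeriv {A P : ℝ → ℂ} (hA : ContDiff ℝ ∞ A) (hP : ContDiff ℝ ∞ P)
    {T₀ T : ℝ} (hT₀ : 0 ≤ T₀) (hT : T₀ < T) (hP0 : ∀ t, T₀ ≤ t → P t = 0) (m i : ℕ) {MQ : ℝ}
    (hMQ0 : 0 ≤ MQ) (hMQ : ∀ l : ℕ, l ≤ i → ∀ t : ℝ, ‖iteratedDeriv l (powDeriv P m) t‖ ≤ MQ)
    {κ c d XA uA : ℝ} (hκ : 0 ≤ κ) (hc : 0 < c) (hd : 0 < d) (hXA : 0 ≤ XA) (huA : 0 ≤ uA)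
    (hAc : DerivBound A c i XA uA) :
    DerivBound (fun c' => A c' * powDeriv P m (κ * d * c')) c i (XA * MQ) (uA + T / c) := by
  have hTc : 0 ≤ T / c := div_nonneg (hT₀.trans hT.le) hc.le
  by_cases hreg : κ * c * d ≤ T
  · -- dilation regime
    have h1 : DerivBound (fun c' => powDeriv P m (κ * d * c')) c i MQ |κ * d| :=
      derivBound_comp_mul (contDiff_powDeriv hP m) hMQ (κ * d) c
    have h2 := DerivBound.mul hA ((contDiff_powDeriv hP m).comp (contDiff_const.mul contDiff_id))
      hAc h1 hXA huA
    refine h2.mono le_rfl le_rfl ?_ (mul_nonneg hXA hMQ0) (by positivity)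
    have hkd : κ * d ≤ T / c := by
      rw [le_div_iff₀ hc]; nlinarith [hreg]
    rw [abs_of_nonneg (by positivity)]
    linarith
  · -- vanishing regime: near `c`, `κ d c' > T₀`, so `powDeriv P m (κ d c') = 0`
    refine DerivBound.of_eventuallyEq_zero ?_ i (mul_nonneg hXA hMQ0) (add_nonneg huA hTc)
    have hlt : T₀ < κ * d * c := by nlinarith [lt_of_not_ge hreg]
    have hev : ∀ᶠ c' in 𝓝 c, T₀ < κ * d * c' :=
      ((continuous_const.mul continuous_id).continuousAt (x := c)).eventually
        (Ioi_mem_nhds hlt)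
    refine hev.mono fun c' hc' => ?_
    have hPz : P =ᶠ[𝓝 (κ * d * c')] 0 := by
      have hev' : ∀ᶠ t in 𝓝 (κ * d * c'), T₀ < t := Ioi_mem_nhds hc'
      exact hev'.mono fun t ht => hP0 t ht.le
    change A c' * powDeriv P m (κ * d * c') = 0
    rw [powDeriv_eq_zero hPz, mul_zero]

/-- **Pointwise bound for the mixed derivatives of the coupled weight** `F(c,d) = A(c)B(d)P(κcd)`:
if `A` has bounds `(XA, uA)` at `c` (orders `≤ i`), `B` has bounds `(XB, uB)` at `d` (orders `≤ j`),
`‖(t^m P^{(m)})^{(l)}‖ ≤ MQ` (`m ≤ j`, `l ≤ i`), `P = 0` on `[T₀,∞)`, `T₀ < T`, `κ ≥ 0`, `c, d > 0`,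
then `‖∂_c^i ∂_d^j F (c,d)‖ ≤ XA·XB·MQ·(uA + T/c)^i·(uB + 1/d)^j`.  For the plateau functions of
Drappeau 2017, §5.5 (`uA, uB ≍ q₀/Y ≤ x^δ/c`, `1/d`) this is the hypothesis of Theorem 2.1 with
`ε₀ ≍ δ`. [cite: Drappeau2017, §5.5] -/
theorem norm_iteratedDeriv_cd_coupled_le {A B P : ℝ → ℂ} (hA : ContDiff ℝ ∞ A) (hB : ContDiff ℝ ∞ B)
    (hP : ContDiff ℝ ∞ P) {T₀ T : ℝ} (hT₀ : 0 ≤ T₀) (hT : T₀ < T) (hP0 : ∀ t, T₀ ≤ t → P t = 0)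
    (i j : ℕ) {MQ : ℝ} (hMQ0 : 0 ≤ MQ)
    (hMQ : ∀ m : ℕ, m ≤ j → ∀ l : ℕ, l ≤ i → ∀ t : ℝ, ‖iteratedDeriv l (powDeriv P m) t‖ ≤ MQ)
    {κ c d XA uA XB uB : ℝ} (hκ : 0 ≤ κ) (hc : 0 < c) (hd : 0 < d) (hXA : 0 ≤ XA) (huA : 0 ≤ uA)
    (hXB : 0 ≤ XB) (huB : 0 ≤ uB) (hAc : DerivBound A c i XA uA) (hBd : DerivBound B d j XB uB) :
    ‖iteratedDeriv i (fun c' => iteratedDeriv j (fun d' => A c' * B d' * P (κ * c' * d')) d) c‖ ≤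
      XA * XB * MQ * (uA + T / c) ^ i * (uB + d⁻¹) ^ j := by
  have hd0 : d ≠ 0 := hd.ne'
  have hTc : 0 ≤ T / c := div_nonneg (hT₀.trans hT.le) hc.le
  -- Step 1: the inner derivative as a finite sum of `const * (A c' * powDeriv P m (κ d c'))`
  have e1 : (fun c' => iteratedDeriv j (fun d' => A c' * B d' * P (κ * c' * d')) d) =
      fun c' => ∑ j₁ ∈ Finset.range (j + 1),
        ((j.choose j₁ : ℂ) * iteratedDeriv j₁ B d * (((d⁻¹ : ℝ) : ℂ) ^ (j - j₁))) *
          (A c' * powDeriv P (j - j₁) (κ * d * c')) := by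
    funext c'
    rw [iteratedDeriv_d_coupled A hB hP κ c' hd0 j, Finset.mul_sum]
    refine Finset.sum_congr rfl fun j₁ _ => ?_
    rw [show κ * c' * d = κ * d * c' by ring]
    ring
  rw [e1]
  -- Step 2: differentiate termwise
  have hterm : ∀ j₁ : ℕ, ContDiff ℝ ∞ (fun c' => A c' * powDeriv P (j - j₁) (κ * d * c')) := fun j₁ =>
    hA.mul ((contDiff_powDeriv hP _).comp (contDiff_const.mul contDiff_id))
  rw [iteratedDeriv_fun_sum (fun j₁ _ => ((contDiff_const.mul (hterm j₁)).of_le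
    (by exact_mod_cast le_top)).contDiffAt)]
  simp_rw [iteratedDeriv_const_mul_field]
  -- Step 3: bound each term
  have hbd : ∀ j₁ ∈ Finset.range (j + 1),
      ‖((j.choose j₁ : ℂ) * iteratedDeriv j₁ B d * (((d⁻¹ : ℝ) : ℂ) ^ (j - j₁))) *
        iteratedDeriv i (fun c' => A c' * powDeriv P (j - j₁) (κ * d * c')) c‖ ≤
      (j.choose j₁ : ℝ) * (XB * uB ^ j₁) * d⁻¹ ^ (j - j₁) * (XA * MQ * (uA + T / c) ^ i) := by
    intro j₁ hj₁
    rw [Finset.mem_range] at hj₁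
    have hD := derivBound_A_mul_powDeriv hA hP hT₀ hT hP0 (j - j₁) i hMQ0 (hMQ (j - j₁) (by omega))
      hκ hc hd hXA huA hAc
    rw [norm_mul, norm_mul, norm_mul, Complex.norm_natCast, norm_pow, Complex.norm_real,
      Real.norm_eq_abs, abs_of_pos (inv_pos.2 hd)]
    exact mul_le_mul (mul_le_mul_of_nonneg_right (mul_le_mul_of_nonneg_left (hBd j₁ (by omega))
      (Nat.cast_nonneg _)) (by positivity)) (hD i le_rfl) (norm_nonneg _) (by positivity)
  -- Step 4: sum
  calc _ ≤ ∑ j₁ ∈ Finset.range (j + 1),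
        (j.choose j₁ : ℝ) * (XB * uB ^ j₁) * d⁻¹ ^ (j - j₁) * (XA * MQ * (uA + T / c) ^ i) :=
        (norm_sum_le _ _).trans (Finset.sum_le_sum hbd)
    _ = XA * XB * MQ * (uA + T / c) ^ i * (uB + d⁻¹) ^ j := by
        rw [add_pow uB, Finset.mul_sum]
        refine Finset.sum_congr rfl fun j₁ _ => ?_
        ring

end KloostermanQuintilinear

end Literature.NumberTheory.Sieve

end
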